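import Summits.ResolutionOfSingularities.ResolutionOfSingularities.Theorems.FrobeniusClosingPatchingRelPerfectConeDepthSmoothConeCharts
import Summits.ResolutionOfSingularities.ResolutionOfSingularities.Theorems.FrobeniusClosingPatchingRelPerfectConeDepthVertexFibre
import HarnessLib

/-!
# Crux `PatchingRelPerfect` (stmt-ResolutionOfSingularities-16161), chain W5.2 — rung «r-smooth-cone-ℓ»: THE VERTEX FIBRE THEOREM for
# the cone over a SMOOTH PLANE CURVE of any degree (arbitrary coefficients)

[OURS · L1 W5.2 · rung tool] Replaces the role of NO printed item; NOT a statement of the manuscript under review; fact-free,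
any characteristic, any residue field, any degree.  AI-written (AI review is weaker than expert review).

Blow up a point `z` of a scheme `X` (`σ` a blowing up along `J`, `J_z = 𝔪_z`), `𝒪_{X,z}` regular of dimension `4` with regular
system of parameters `c₀, …, c₃`; follow the host `𝓗_z = (N(c₁, c₂, c₃))`, `N ∈ 𝒪_{X,z}[U₀,U₁,U₂]` a form of degree `d` whose
reduced curve `V(N̄) ⊂ ℙ²` is smooth (certificates (HV) on the vertex chart and (HC) on the three other charts, as in
`…SmoothConeCharts`), and the carrier `G_z = (c₀)`.  THEN (`smoothCone_vertex_fibre`): over `z` there is exactly one bad point,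
the NEW VERTEX `z'`, where `𝒪_{X',z'}` is regular of dimension `4` with a regular system of parameters `c'` in which the exceptional
divisor is `(c'₀)`, the weight-`d` controlled transform of `𝓗` is `(N'(c'₁, c'₂, c'₃))` with `N' = N^ψ` the SAME form moved along the
local homomorphism `ψ : 𝒪_{X,z} → 𝒪_{X',z'}` (so again of degree `d` with the certificates (HV), (HC)), and the strict transform of
`G` is empty; at every other point over `z` the three ideal sheaves (host transform, exceptional divisor, transform of `G`) have simple
normal crossings.  This is g4's `vertex_fibre` (the quadric cone `c₁c₂ + c₃²`, weight `2`) for every cone over a smooth plane curve.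

## References
* J. Kollár, *Lectures on Resolution of Singularities* (2007), 3.61, Def. 3.24. [Kollar2007]
* The Stacks Project, Tags 0804, 0BIQ. [StacksProject]
* H. Matsumura, *Commutative Ring Theory*, CUP 1986, Thm. 14.2, Thm. 30.3. [Matsumura1987]
-/

set_option linter.dupNamespace false

noncomputable section

open CategoryTheory CategoryTheory.Limits AlgebraicGeometry TopologicalSpace IsLocalRing
open Literature.AlgebraicGeometry.Resolution
open Scheme.IdealSheafData
open scoped Pointwise

namespace Summit.ResolutionOfSingularities.ResolutionOfSingularities.Theorems

universe u

namespace ConeDepth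

/-! ## Transport of the certificates along a local homomorphism -/

section Transport

variable {R R' : Type u} [CommRing R] [IsLocalRing R] [CommRing R'] [IsLocalRing R'] (g : R →+* R') [IsLocalHom g]
  (N : MvPolynomial (Fin 3) R)

/-- (HC) moves along a local homomorphism. [cite: Matsumura1987, Thm. 30.3] -/
theorem coneHC_map (i : Fin 4)
    (hC : Ideal.span (insert (chartPoly (MvPolynomial.rename Fin.succ N) i)
      (Set.range fun t => MvPolynomial.pderiv t (chartPoly (MvPolynomial.rename Fin.succ N) i))) = ⊤) :
    Ideal.span (insert (chartPoly (MvPolynomial.rename Fin.succ (MvPolynomial.map g N)) i)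
      (Set.range fun t => MvPolynomial.pderiv t (chartPoly (MvPolynomial.rename Fin.succ (MvPolynomial.map g N)) i))) = ⊤ := by
  rw [← MvPolynomial.map_rename]
  exact span_chartPoly_pderiv_eq_top_map _ i g hC

/-- (HV) moves along a local homomorphism. [cite: Matsumura1987, Thm. 30.3] -/
theorem coneHV_map
    (hV : ∃ m : ℕ, Ideal.span (Set.range (MvPolynomial.X : {j : Fin 4 // j ≠ (0 : Fin 4)} → _)) ^ m ≤
      Ideal.span (insert (chartPoly (MvPolynomial.rename Fin.succ N) 0)
        (Set.range fun t => MvPolynomial.pderiv t (chartPoly (MvPolynomial.rename Fin.succ N) 0)))) :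
    ∃ m : ℕ, Ideal.span (Set.range (MvPolynomial.X : {j : Fin 4 // j ≠ (0 : Fin 4)} → _)) ^ m ≤
      Ideal.span (insert (chartPoly (MvPolynomial.rename Fin.succ (MvPolynomial.map g N)) 0)
        (Set.range fun t => MvPolynomial.pderiv t (chartPoly (MvPolynomial.rename Fin.succ (MvPolynomial.map g N)) 0))) := by
  obtain ⟨m, hm⟩ := hV
  refine ⟨m, ?_⟩
  have h := Ideal.map_mono (f := MvPolynomial.map (σ := {j : Fin 4 // j ≠ (0 : Fin 4)}) (ResidueField.map g)) hm
  rw [Ideal.map_pow, Ideal.map_span, ← Set.range_comp, Ideal.map_span, Set.image_insert_eq, ← Set.range_comp] at h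
  have hX : ((MvPolynomial.map (σ := {j : Fin 4 // j ≠ (0 : Fin 4)}) (ResidueField.map g)) ∘ MvPolynomial.X) =
      MvPolynomial.X := by
    funext k
    rw [Function.comp_apply, MvPolynomial.map_X]
  have hfun : (fun t => MvPolynomial.pderiv t (chartPoly (MvPolynomial.rename Fin.succ (MvPolynomial.map g N)) 0)) =
      (MvPolynomial.map (ResidueField.map g)) ∘
        (fun t => MvPolynomial.pderiv t (chartPoly (MvPolynomial.rename Fin.succ N) 0)) := by
    funext t
    rw [Function.comp_apply, ← MvPolynomial.map_rename, chartPoly_map, MvPolynomial.pderiv_map]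
  rw [hX] at h
  rw [hfun, ← MvPolynomial.map_rename, chartPoly_map]
  exact h

omit [IsLocalRing R'] [IsLocalHom g] in
/-- (HV) forces `F₀ ≠ 0`. [folklore] -/
theorem chartPoly_zero_ne_zero_of_hV
    (hV : ∃ m : ℕ, Ideal.span (Set.range (MvPolynomial.X : {j : Fin 4 // j ≠ (0 : Fin 4)} → _)) ^ m ≤
      Ideal.span (insert (chartPoly (MvPolynomial.rename Fin.succ N) 0)
        (Set.range fun t => MvPolynomial.pderiv t (chartPoly (MvPolynomial.rename Fin.succ N) 0)))) :
    chartPoly (MvPolynomial.rename Fin.succ N) 0 ≠ 0 := by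
  intro h0
  obtain ⟨m, hm⟩ := hV
  rw [h0] at hm
  have hle : Ideal.span (insert (0 : MvPolynomial {j : Fin 4 // j ≠ (0 : Fin 4)} (ResidueField R))
      (Set.range fun t => MvPolynomial.pderiv t (0 : MvPolynomial {j : Fin 4 // j ≠ (0 : Fin 4)} (ResidueField R)))) ≤ ⊥ := by
    rw [Ideal.span_le]
    rintro G (rfl | ⟨t, rfl⟩)
    · exact zero_mem _
    · simp
  have hX1 : (MvPolynomial.X ⟨1, by decide⟩ : MvPolynomial {j : Fin 4 // j ≠ (0 : Fin 4)} (ResidueField R)) ∈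
      Ideal.span (Set.range (MvPolynomial.X : {j : Fin 4 // j ≠ (0 : Fin 4)} → _)) :=
    Ideal.subset_span (Set.mem_range_self _)
  have hXm := Ideal.pow_mem_pow hX1 m
  have h := (hm.trans hle) hXm
  rw [Ideal.mem_bot] at h
  exact MvPolynomial.X_ne_zero _ (pow_eq_zero_iff'.mp h).1

end Transport

/-! ## §6' THE VERTEX FIBRE THEOREM for the cone over a smooth plane curve -/

section SmoothConeFibre

variable {X' X : Scheme.{u}} {σ : X' ⟶ X} {J : X.IdealSheafData}
  (hσ : IsBlowup σ J) (z : X) (c : Fin 4 → X.presheaf.stalk z) [IsRegularLocalRing (X.presheaf.stalk z)]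
  (hz𝔪 : Ideal.span (Set.range c) = maximalIdeal (X.presheaf.stalk z))
  (hd : (maximalIdeal (X.presheaf.stalk z)).spanFinrank = 4)
  (hJ : stalkIdeal J z = maximalIdeal (X.presheaf.stalk z)) (deg : ℕ)
  (N : MvPolynomial (Fin 3) (X.presheaf.stalk z)) (hN : N.IsHomogeneous deg)
  (hV : ∃ m : ℕ, Ideal.span (Set.range (MvPolynomial.X : {j : Fin 4 // j ≠ (0 : Fin 4)} → _)) ^ m ≤
      Ideal.span (insert (chartPoly (MvPolynomial.rename Fin.succ N) 0)
        (Set.range fun t => MvPolynomial.pderiv t (chartPoly (MvPolynomial.rename Fin.succ N) 0))))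
  (hC : ∀ i : Fin 4, i ≠ 0 → Ideal.span (insert (chartPoly (MvPolynomial.rename Fin.succ N) i)
      (Set.range fun t => MvPolynomial.pderiv t (chartPoly (MvPolynomial.rename Fin.succ N) i))) = ⊤)
  (𝓗 G : X.IdealSheafData)
  (h𝓗 : stalkIdeal 𝓗 z = Ideal.span {MvPolynomial.eval (fun k : Fin 3 => c k.succ) N}) (hG : stalkIdeal G z = Ideal.span {c 0})
  (q : (j : Fin 4) → (Spec (.of (chartRing c j)) ⟶ X'))
  (hqσ : ∀ j, q j ≫ σ = Spec.map (CommRingCat.ofHom (chartBase c j)) ≫ X.fromSpecStalk z)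
  (hqiso : ∀ j (w : Spec (.of (chartRing c j))), IsIso ((q j).stalkMap w))

include hN in
omit [IsRegularLocalRing (X.presheaf.stalk z)] in
/-- `χ(φ(N(c₁,c₂,c₃))) = χ(φ(c_j))^d · χ(f_j)` on chart `j` under any ring homomorphism `χ`, `f_j` the chart form of
`N(T₁,T₂,T₃)`. [cite: StacksProject, Tag 052P] -/
theorem map_chartBase_eval_succ_eq (j : Fin 4) {T : Type u} [CommRing T] (χ : chartRing c j →+* T) :
    χ (chartBase c j (MvPolynomial.eval (fun k : Fin 3 => c k.succ) N)) =
      χ (chartBase c j (c j)) ^ deg * χ (chartForm (MvPolynomial.rename Fin.succ N) c j) := by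
  have h : MvPolynomial.eval (fun k : Fin 3 => c k.succ) N = MvPolynomial.eval c (MvPolynomial.rename Fin.succ N) :=
    (MvPolynomial.eval_rename Fin.succ c N).symm
  rw [h, ← map_pow, ← map_mul]
  congr 1
  exact reesChartBase_eval_eq_pow_mul_eval₂ c j hN.rename_isHomogeneous

include hqσ hz𝔪 hd hJ hN hV hC h𝓗 hG hσ hqiso in
/-- **The fibre over the vertex, (V): the NEW VERTEX.**  At `z' = q₀(vertex prime)`: the weight-`d` transform of the host, the
exceptional divisor and the weight-one transform of the old carrier read `((N'(c'₁,c'₂,c'₃)), (c'₀), ⊤)` in a regular system of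
parameters `c'` of the regular four-dimensional `𝒪_{X',z'}`, with `N' = N^ψ` again a form of degree `d` carrying the certificates.
[cite: StacksProject, Tag 0804] -/
theorem smoothConeFibre_vertex (x₀ : X') (hx₀ : q 0 (vertexPoint z c hz𝔪 hd) = x₀) :
    ∃ c' : Fin 4 → X'.presheaf.stalk x₀,
      IsRegularLocalRing (X'.presheaf.stalk x₀) ∧ Ideal.span (Set.range c') = maximalIdeal _ ∧
      (maximalIdeal (X'.presheaf.stalk x₀)).spanFinrank = 4 ∧
      stalkIdeal (J.comap σ) x₀ = Ideal.span {c' 0} ∧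
      (∃ N' : MvPolynomial (Fin 3) (X'.presheaf.stalk x₀), N'.IsHomogeneous deg ∧
        (∃ m : ℕ, Ideal.span (Set.range (MvPolynomial.X : {j : Fin 4 // j ≠ (0 : Fin 4)} → _)) ^ m ≤
          Ideal.span (insert (chartPoly (MvPolynomial.rename Fin.succ N') 0)
            (Set.range fun t => MvPolynomial.pderiv t (chartPoly (MvPolynomial.rename Fin.succ N') 0)))) ∧
        (∀ i : Fin 4, i ≠ 0 → Ideal.span (insert (chartPoly (MvPolynomial.rename Fin.succ N') i)
          (Set.range fun t => MvPolynomial.pderiv t (chartPoly (MvPolynomial.rename Fin.succ N') i))) = ⊤) ∧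
        stalkIdeal (controlledTransform σ J 𝓗 deg) x₀ = Ideal.span {MvPolynomial.eval (fun k : Fin 3 => c' k.succ) N'}) ∧
      stalkIdeal (controlledTransform σ J G 1) x₀ = ⊤ := by
  classical
  have hc := span_eq_stalkIdeal_centre z c hz𝔪 hJ
  have hwv : (vertexPoint z c hz𝔪 hd).asIdeal.comap (chartBase c 0) = maximalIdeal _ := comap_vertexIdeal c hz𝔪 hd
  have hz₀ : σ x₀ = z := by rw [← hx₀]; exact apply_chart_eq_of_comap (hqσ 0) _ hwv
  haveI := hqiso 0 (vertexPoint z c hz𝔪 hd)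
  obtain ⟨χ, hχ, hloc, -⟩ := exists_stalk_presentation c 0 (q 0) (hqσ 0) (vertexPoint z c hz𝔪 hd) hx₀ hz₀
  letI : Algebra (chartRing c 0) (X'.presheaf.stalk x₀) := χ.toAlgebra
  haveI := hloc
  have hm := mem_vertexIdeal c
  haveI : (vertexPoint z c hz𝔪 hd).asIdeal.IsPrime := (vertexPoint z c hz𝔪 hd).isPrime
  obtain ⟨v, hv, hvspan, hv0, hv1, hv2, hv3, -⟩ :=
    coneVertex c hz𝔪 hd (vertexPoint z c hz𝔪 hd).asIdeal hwv (X'.presheaf.stalk x₀) hm.2.1 hm.2.2.1 hm.2.2.2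
  have hnzd : χ (chartBase c 0 (c 0)) ∈ nonZeroDivisors (X'.presheaf.stalk x₀) :=
    algebraMap_centre_mem_nonZeroDivisors c 0 (X'.presheaf.stalk x₀) (chartBase c 0)
      (reesChartBase_mem_nonZeroDivisors (c 0) (Ideal.mem_span_range_self (f := c) (x := 0))) (vertexPoint z c hz𝔪 hd).asIdeal
  -- the structure map `ψ : 𝒪_{X,z} → 𝒪_{X',x₀}` through the chart is local
  haveI hψ : IsLocalHom (((algebraMap (chartRing c 0) (X'.presheaf.stalk x₀) :
      chartRing c 0 →+* X'.presheaf.stalk x₀)).comp (chartBase c 0)) :=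
    isLocalHom_of_comap_eq (chartBase c 0) (vertexPoint z c hz𝔪 hd).asIdeal hwv
  set ψ := ((algebraMap (chartRing c 0) (X'.presheaf.stalk x₀) : chartRing c 0 →+* X'.presheaf.stalk x₀)).comp (chartBase c 0)
    with hψdef
  have hvs : ∀ k : Fin 3, v k.succ = (algebraMap (chartRing c 0) (X'.presheaf.stalk x₀) :
      chartRing c 0 →+* X'.presheaf.stalk x₀) (chartGen c 0 k.succ) := by
    intro k
    fin_cases k
    exacts [hv1, hv2, hv3]
  refine ⟨v, hv.isRegularLocalRing, hvspan, ?_, ?_, ⟨MvPolynomial.map ψ N, hN.map ψ, coneHV_map ψ N hV,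
    fun i hi => coneHC_map ψ N i (hC i hi), ?_⟩, ?_⟩
  · -- `μ(𝔪) = 4`
    obtain ⟨e, -, hde, -, -⟩ := hv.exists_rsop
    have hle : (maximalIdeal (X'.presheaf.stalk x₀)).spanFinrank ≤ 4 := by
      rw [← hvspan, ← Set.image_univ]
      refine (Submodule.spanFinrank_span_le_ncard_of_finite (Set.toFinite _)).trans ?_
      refine (Set.ncard_image_le (Set.toFinite _)).trans ?_
      rw [Set.ncard_univ, Nat.card_eq_fintype_card, Fintype.card_fin]
    omega
  · rw [stalkIdeal_exceptional_of_presentation χ hz₀ hχ hc, hv0]; rfl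
  · rw [stalkIdeal_controlledTransform_of_presentation χ hz₀ hχ hσ hc hnzd 𝓗 _ h𝓗 deg
        (chartForm (MvPolynomial.rename Fin.succ N) c 0) (map_chartBase_eval_succ_eq z c deg N hN 0 χ)]
    have h := algebraMap_chartForm_rename_succ N c v hvs
    rw [← hψdef] at h
    exact congrArg (fun t => Ideal.span {t}) h
  · have h1 : chartGen c 0 0 = 1 := chartGen_self c 0
    rw [stalkIdeal_controlledTransform_of_presentation χ hz₀ hχ hσ hc hnzd G _ hG 1 (chartGen c 0 0) ?_]
    · rw [h1, map_one, Ideal.span_singleton_one]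
    · rw [h1, map_one, mul_one, pow_one]

include hσ hz𝔪 hJ hN h𝓗 hG hqσ hqiso in
omit [IsRegularLocalRing (X.presheaf.stalk z)] in
/-- **Presentation of a point of the fibre on chart `j`**: `𝒪_{X',x'} = (B_j)_w`, `w ∩ 𝒪_{X,z} = 𝔪_z`, and the three stalks read
`(φ c_j)`, `(f_j)`, `(e₀)`. [cite: StacksProject, Tag 0804] -/
theorem smoothCone_offVertex_presentation (j : Fin 4) (w : PrimeSpectrum (chartRing c j)) (x' : X') (hx' : q j w = x')
    (hz' : σ x' = z) :
    ∃ χ : chartRing c j →+* X'.presheaf.stalk x',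
      @IsLocalization.AtPrime _ _ (X'.presheaf.stalk x') _ χ.toAlgebra w.asIdeal _ ∧
      w.asIdeal.comap (chartBase c j) = maximalIdeal (X.presheaf.stalk z) ∧
      stalkIdeal (J.comap σ) x' = Ideal.span {χ (chartBase c j (c j))} ∧
      stalkIdeal (controlledTransform σ J 𝓗 deg) x' = Ideal.span {χ (chartForm (MvPolynomial.rename Fin.succ N) c j)} ∧
      stalkIdeal (controlledTransform σ J G 1) x' = Ideal.span {χ (chartGen c j 0)} := by
  classical
  have hc := span_eq_stalkIdeal_centre z c hz𝔪 hJ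
  haveI := hqiso j w
  obtain ⟨χ, hχ, hloc, hw𝔪⟩ := exists_stalk_presentation c j (q j) (hqσ j) w hx' hz'
  letI : Algebra (chartRing c j) (X'.presheaf.stalk x') := χ.toAlgebra
  haveI := hloc
  have hnzd : χ (chartBase c j (c j)) ∈ nonZeroDivisors (X'.presheaf.stalk x') :=
    algebraMap_centre_mem_nonZeroDivisors c j (X'.presheaf.stalk x') (chartBase c j)
      (reesChartBase_mem_nonZeroDivisors (c j) (Ideal.mem_span_range_self (f := c) (x := j))) w.asIdeal
  refine ⟨χ, hloc, hw𝔪, stalkIdeal_exceptional_of_presentation χ hz' hχ hc, ?_, ?_⟩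
  · exact stalkIdeal_controlledTransform_of_presentation χ hz' hχ hσ hc hnzd 𝓗 _ h𝓗 deg _
      (map_chartBase_eval_succ_eq z c deg N hN j χ)
  · exact stalkIdeal_controlledTransform_of_presentation χ hz' hχ hσ hc hnzd G _ hG 1 (chartGen c j 0)
      (by rw [reesChartBase_apply_eq_mul_chartGen c j 0, map_mul, pow_one])

include hσ hz𝔪 hd hJ hN hV h𝓗 hG hqσ hqiso in
/-- **The fibre of the vertex, chart `0`, off the vertex**: simple normal crossings of the host transform, the exceptional divisor
and the (empty) transform of the old carrier. [cite: Kollar2007, Def. 3.24] -/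
theorem smoothCone_sncWithAt_chart_zero (w : PrimeSpectrum (chartRing c 0)) (x' : X') (hx' : q 0 w = x') (hz' : σ x' = z)
    (hne : x' ≠ q 0 (vertexPoint z c hz𝔪 hd)) :
    DepthSNC.SNCWithAt [controlledTransform σ J 𝓗 deg, J.comap σ, controlledTransform σ J G 1] ⊤ x' := by
  classical
  obtain ⟨χ, hloc, hw𝔪, hstE, hstH, hstG⟩ :=
    smoothCone_offVertex_presentation hσ z c hz𝔪 hJ deg N hN 𝓗 G h𝓗 hG q hqσ hqiso 0 w x' hx' hz'
  letI : Algebra (chartRing c 0) (X'.presheaf.stalk x') := χ.toAlgebra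
  haveI := hloc
  have hnv : ¬ (chartGen c 0 1 ∈ w.asIdeal ∧ chartGen c 0 2 ∈ w.asIdeal ∧ chartGen c 0 3 ∈ w.asIdeal) := by
    rintro ⟨h1, h2, h3⟩
    have hw : w.asIdeal = vertexIdeal c := eq_vertexIdeal c hz𝔪 hd w.asIdeal hw𝔪 h1 h2 h3
    have hwv : w = vertexPoint z c hz𝔪 hd := PrimeSpectrum.ext hw
    exact hne (by rw [← hx', hwv])
  have hG' : x' ∉ (controlledTransform σ J G 1).support := by
    intro hx
    have h1 : chartGen c 0 0 = 1 := chartGen_self c 0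
    have hmem := mem_of_mem_support χ w.asIdeal hloc hstG hx
    rw [h1] at hmem
    exact w.isPrime.ne_top ((Ideal.eq_top_iff_one _).mpr hmem)
  have hne' := chartForm_ne_chartBase (MvPolynomial.rename Fin.succ N) c hz𝔪 hd 0 (chartPoly_zero_ne_zero_of_hV N hV)
  have key : DepthSNC.SNCWithAt ([(J.comap σ, chartBase c 0 (c 0)),
      (controlledTransform σ J 𝓗 deg, chartForm (MvPolynomial.rename Fin.succ N) c 0)].map Prod.fst) ⊤ x' := by
    refine sncWithAt_of_adapted χ w.asIdeal hloc _ ?_ ?_ ?_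
    · intro p hp
      simp only [List.mem_cons, List.not_mem_nil, or_false] at hp
      rcases hp with rfl | rfl
      · exact hstE
      · exact hstH
    · intro p hp p' hp' h
      simp only [List.mem_cons, List.not_mem_nil, or_false] at hp hp'
      rcases hp with rfl | rfl <;> rcases hp' with rfl | rfl
      · rfl
      · exact absurd h.symm hne'
      · exact absurd h hne'
      · rfl
    · exact smoothConeChart_zero N c hz𝔪 hd w.asIdeal hw𝔪 (X'.presheaf.stalk x') hV hnv
  refine key.anti fun D hD hxD => ?_
  simp only [List.mem_cons, List.not_mem_nil, or_false] at hD
  simp only [List.map_cons, List.map_nil, List.mem_cons, List.not_mem_nil, or_false]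
  rcases hD with rfl | rfl | rfl
  · exact Or.inr rfl
  · exact Or.inl rfl
  · exact absurd hxD hG'

include hσ hz𝔪 hd hJ hN hC h𝓗 hG hqσ hqiso in
/-- **The fibre of the vertex, charts `i ≠ 0`**: simple normal crossings of the host transform, the exceptional divisor and the
strict transform of the old carrier. [cite: Kollar2007, Def. 3.24] -/
theorem smoothCone_sncWithAt_chart_ne_zero (i : Fin 4) (hi0 : i ≠ 0) (w : PrimeSpectrum (chartRing c i)) (x' : X')
    (hx' : q i w = x') (hz' : σ x' = z) :
    DepthSNC.SNCWithAt [controlledTransform σ J 𝓗 deg, J.comap σ, controlledTransform σ J G 1] ⊤ x' := by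
  classical
  obtain ⟨χ, hloc, hw𝔪, hstE, hstH, hstG⟩ :=
    smoothCone_offVertex_presentation hσ z c hz𝔪 hJ deg N hN 𝓗 G h𝓗 hG q hqσ hqiso i w x' hx' hz'
  letI : Algebra (chartRing c i) (X'.presheaf.stalk x') := χ.toAlgebra
  haveI := hloc
  have hn1 := chartForm_ne_chartBase (MvPolynomial.rename Fin.succ N) c hz𝔪 hd i
    (chartPoly_ne_zero_of_smooth (MvPolynomial.rename Fin.succ N) i (hC i hi0))
  have hn2 := chartForm_rename_succ_ne_chartGen_zero N c hz𝔪 hd i (Ne.symm hi0)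
  have hn3 := chartGen_zero_ne_chartBase c hz𝔪 hd i (Ne.symm hi0)
  have key : DepthSNC.SNCWithAt ([(J.comap σ, chartBase c i (c i)), (controlledTransform σ J G 1, chartGen c i 0),
      (controlledTransform σ J 𝓗 deg, chartForm (MvPolynomial.rename Fin.succ N) c i)].map Prod.fst) ⊤ x' := by
    refine sncWithAt_of_adapted χ w.asIdeal hloc _ ?_ ?_ ?_
    · intro p hp
      simp only [List.mem_cons, List.not_mem_nil, or_false] at hp
      rcases hp with rfl | rfl | rfl
      · exact hstE
      · exact hstG
      · exact hstH
    · intro p hp p' hp' h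
      simp only [List.mem_cons, List.not_mem_nil, or_false] at hp hp'
      rcases hp with rfl | rfl | rfl <;> rcases hp' with rfl | rfl | rfl
      · rfl
      · exact absurd h.symm hn3
      · exact absurd h.symm hn1
      · exact absurd h hn3
      · rfl
      · exact absurd h.symm hn2
      · exact absurd h hn1
      · exact absurd h hn2
      · rfl
    · exact smoothConeChart_ne_zero N c hz𝔪 hd i w.asIdeal hw𝔪 (X'.presheaf.stalk x') hi0 (hC i hi0)
  refine key.anti fun D hD _ => ?_
  simp only [List.mem_cons, List.not_mem_nil, or_false] at hD
  simp only [List.map_cons, List.map_nil, List.mem_cons, List.not_mem_nil, or_false]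
  rcases hD with rfl | rfl | rfl
  · exact Or.inr (Or.inr rfl)
  · exact Or.inl rfl
  · exact Or.inr (Or.inl rfl)

include hσ hz𝔪 hd hJ hN hV hC h𝓗 hG in
/-- **THE VERTEX FIBRE THEOREM FOR THE CONE OVER A SMOOTH PLANE CURVE.**  Blow up a point `z` (`J_z = 𝔪_z`, `𝒪_{X,z}` regular of
dimension `4`, regular system of parameters `c`), follow the host `𝓗_z = (N(c₁,c₂,c₃))` (`N` a form of degree `d` with smooth
reduced plane curve: certificates (HV), (HC)) and the carrier `G_z = (c₀)`.  Over `z` there is exactly one bad point `z'`: there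
the local ring is regular of dimension `4` with a regular system of parameters `c'` reading the exceptional divisor as `(c'₀)`, the
weight-`d` transform of `𝓗` as the cone `(N'(c'₁,c'₂,c'₃))` over the same curve (`N' = N^ψ`, certificates preserved) and the transform
of `G` as `⊤`; everywhere else over `z` the three ideals have simple normal crossings. [cite: Kollar2007, 3.61]
[cite: StacksProject, Tag 0804] -/
theorem smoothCone_vertex_fibre :
    ∃ z' : X', σ z' = z ∧
      (∃ c' : Fin 4 → X'.presheaf.stalk z',
        IsRegularLocalRing (X'.presheaf.stalk z') ∧ Ideal.span (Set.range c') = maximalIdeal _ ∧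
        (maximalIdeal (X'.presheaf.stalk z')).spanFinrank = 4 ∧
        stalkIdeal (J.comap σ) z' = Ideal.span {c' 0} ∧
        (∃ N' : MvPolynomial (Fin 3) (X'.presheaf.stalk z'), N'.IsHomogeneous deg ∧
          (∃ m : ℕ, Ideal.span (Set.range (MvPolynomial.X : {j : Fin 4 // j ≠ (0 : Fin 4)} → _)) ^ m ≤
            Ideal.span (insert (chartPoly (MvPolynomial.rename Fin.succ N') 0)
              (Set.range fun t => MvPolynomial.pderiv t (chartPoly (MvPolynomial.rename Fin.succ N') 0)))) ∧
          (∀ i : Fin 4, i ≠ 0 → Ideal.span (insert (chartPoly (MvPolynomial.rename Fin.succ N') i)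
            (Set.range fun t => MvPolynomial.pderiv t (chartPoly (MvPolynomial.rename Fin.succ N') i))) = ⊤) ∧
          stalkIdeal (controlledTransform σ J 𝓗 deg) z' = Ideal.span {MvPolynomial.eval (fun k : Fin 3 => c' k.succ) N'}) ∧
        stalkIdeal (controlledTransform σ J G 1) z' = ⊤) ∧
      ∀ x' : X', σ x' = z → x' ≠ z' →
        DepthSNC.SNCWithAt [controlledTransform σ J 𝓗 deg, J.comap σ, controlledTransform σ J G 1] ⊤ x' := by
  classical
  obtain ⟨q, hqσ, hqiso, hcov⟩ := exists_charts_over hσ z c (span_eq_stalkIdeal_centre z c hz𝔪 hJ)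
  refine ⟨q 0 (vertexPoint z c hz𝔪 hd), ?_,
    smoothConeFibre_vertex hσ z c hz𝔪 hd hJ deg N hN hV hC 𝓗 G h𝓗 hG q hqσ hqiso _ rfl, ?_⟩
  · exact apply_chart_eq_of_comap (hqσ 0) _ (comap_vertexIdeal c hz𝔪 hd)
  · intro x' hx' hne
    obtain ⟨j, w, hqw⟩ := hcov x' hx'
    by_cases hj : j = 0
    · subst hj
      exact smoothCone_sncWithAt_chart_zero hσ z c hz𝔪 hd hJ deg N hN hV 𝓗 G h𝓗 hG q hqσ hqiso w x' hqw hx' hne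
    · exact smoothCone_sncWithAt_chart_ne_zero hσ z c hz𝔪 hd hJ deg N hN hC 𝓗 G h𝓗 hG q hqσ hqiso j hj w x' hqw hx'

end SmoothConeFibre

end ConeDepth

end Summit.ResolutionOfSingularities.ResolutionOfSingularities.Theorems

end
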